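import Literature.NumberTheory.LFunctions.KowalskiMichelHarmonicMoments
import Literature.NumberTheory.EllipticCurves.TwistedLValueSeries
import Mathlib.Analysis.Normed.Module.FiniteDimension
import HarnessLib

/-!
# The harmonic first moment through the damped series: `Σ^h_f λ_f(m) D_f(y) = Σ_n w_y(n) · Σ^h_f λ_f(m)λ_f(n)`
# (Bettin 2017, §2, first line of (2.3): the finite harmonic average exchanged with the `n`-sum)

Topic `Literature/NumberTheory/LFunctions` (cell landau-siegel / ls-inputs, input I2 =
`bettin2017_theorem11_primeLevel`, line `hecke_afe_petersson`, stub S2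
`stub_harmonicSum_dampedTwist`).

For a level `N`, an integer `m`, and a height `y > 0`, write `D_f(y) = Σ_{n ≥ 1} a_f(n) e^{−2πny}/n`
(`dampedTwist f 1 y`) for `f ∈ S_2(Γ₀(N))`, `λ_f(n) = a_f(n) n^{−1/2}` (`GL2Family.heckeLambda`, the
analytic normalisation at weight `2`), `w_y(n) = n^{−1/2} e^{−2πny}` and
`pet N m n = Σ^h_{f ∈ H_2(N)} λ_f(m) λ_f(n)` (`KowalskiMichel2000.pet`, the left side of Petersson's
formula). Then, since `a_f(n) e^{−2πny}/n = w_y(n) λ_f(n)` termwise and the harmonic average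
`Σ^h = GL2Family.harmonicSum N 2` is a FINITE sum over the Hecke-normalised newforms `newforms0 N 2`
(`finite_newforms0_holds`),

  `Σ^h_f λ_f(m) D_f(y) = Σ_n w_y(n) · pet N m n`,

the `n`-series converging absolutely (each `D_f(y)` converges absolutely, `summable_dampedTwist`).
This is the first line of Bettin's (2.3) — the step "applying Petersson's formula inside the
approximate functional equation" — in the exact two-sided set-up of the I2 skeleton (cutoff
`e^{−2πny}` in place of Bettin's `V(n/Y)`). Pure bookkeeping: everything here is proved; no
definition, no named fact, and no claim about Landau–Siegel zeros.

## References
* [Bettin2017] S. Bettin, *The first moment of twisted Hecke L-functions with unbounded shifts*,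
  Funct. Approx. Comment. Math. 57 (2017) = arXiv:1605.02440, §2, (2.3) (first line).
* [IwaniecKowalski2004] H. Iwaniec, E. Kowalski, *Analytic Number Theory*, (14.59)–(14.60)
  (the harmonic average and the analytic normalisation `λ_f`).
-/

noncomputable section

open scoped Real
open Complex CongruenceSubgroup
open Literature.NumberTheory.EllipticCurves.ModularForms

namespace Literature.NumberTheory.LFunctions.Bettin2017

variable {N : ℕ}

/-- At weight `2` the analytic normalisation reads `λ_f(n) = a_f(n) · n^{−1/2}` with a REAL power
(Iwaniec–Kowalski §14.10, the display before (14.59), `k = 2`).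
[cite: IwaniecKowalski2004, §14.10 (display before (14.59))] -/
theorem heckeLambda_weight_two (f : CuspForm (Gamma0 N) 2) (n : ℕ) :
    GL2Family.heckeLambda f n = cuspCoeff f n * (((n : ℝ) ^ (-(1 / 2 : ℝ)) : ℝ) : ℂ) := by
  rw [GL2Family.heckeLambda_def]
  have hexp : -((((2 : ℤ) : ℂ) - 1) / 2) = ((-(1 / 2 : ℝ) : ℝ) : ℂ) := by push_cast; ring
  rw [hexp, ← Complex.ofReal_natCast, ← Complex.ofReal_cpow (Nat.cast_nonneg n)]

/-- The termwise identity behind Bettin's (2.3): `a_f(n) e^{−2πny}/n = w_y(n) · λ_f(n)` with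
`w_y(n) = n^{−1/2} e^{−2πny}`, `λ_f(n) = a_f(n) n^{−1/2}` (both sides vanish at `n = 0`).
[cite: Bettin2017, §2 (2.3)] -/
theorem cuspCoeff_mul_exp_div_eq (f : CuspForm (Gamma0 N) 2) (y : ℝ) (n : ℕ) :
    (1 : ℂ) * cuspCoeff f n * (Real.exp (-(2 * Real.pi * n) * y) / n : ℝ) =
      (((n : ℝ) ^ (-(1 / 2 : ℝ)) * Real.exp (-(2 * Real.pi * n) * y) : ℝ) : ℂ) *
        GL2Family.heckeLambda f n := by
  rw [heckeLambda_weight_two]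
  rcases Nat.eq_zero_or_pos n with rfl | hn
  · simp
  · have hn0 : (0 : ℝ) < n := by exact_mod_cast hn
    have hpow : (n : ℝ) ^ (-(1 / 2 : ℝ)) * (n : ℝ) ^ (-(1 / 2 : ℝ)) = (n : ℝ)⁻¹ := by
      rw [← Real.rpow_add hn0, show (-(1 / 2 : ℝ)) + -(1 / 2 : ℝ) = -1 by norm_num,
        Real.rpow_neg_one]
    have hreal : Real.exp (-(2 * Real.pi * n) * y) / n =
        ((n : ℝ) ^ (-(1 / 2 : ℝ)) * Real.exp (-(2 * Real.pi * n) * y)) *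
          (n : ℝ) ^ (-(1 / 2 : ℝ)) := by
      rw [div_eq_mul_inv, ← hpow]; ring
    rw [hreal]
    push_cast
    ring

/-- For each form `f`, the damped series with the `λ_f(m)`-twist and the harmonic weight pulled
inside: the `n`-th term is `ω_f λ_f(m) · w_y(n) λ_f(n)` and the series is summable.
[cite: Bettin2017, §2 (2.3)] -/
theorem summable_harmonicWeight_mul_heckeLambda_mul [NeZero N] (f : CuspForm (Gamma0 N) 2)
    (m : ℕ) {y : ℝ} (hy : 0 < y) :
    Summable fun n : ℕ ↦ (GL2Family.harmonicWeight f : ℂ) *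
      (GL2Family.heckeLambda f m *
        ((((n : ℝ) ^ (-(1 / 2 : ℝ)) * Real.exp (-(2 * Real.pi * n) * y) : ℝ) : ℂ) *
          GL2Family.heckeLambda f n)) := by
  have hs := summable_dampedTwist f (w := fun _ ↦ (1 : ℂ)) (B := 1) (fun _ ↦ by simp) hy
  simp_rw [cuspCoeff_mul_exp_div_eq] at hs
  exact (hs.mul_left _).mul_left _

/-- **The harmonic first moment through the damped series** (Bettin 2017, §2, first line of
(2.3), in the exact two-sided set-up): for every level `N`, every `m : ℕ` and every `y > 0`,
`Σ^h_f λ_f(m) D_f(y) = Σ_n n^{−1/2} e^{−2πny} · Σ^h_f λ_f(m)λ_f(n)` (`= Σ_n w_y(n) · pet N m n`), and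
the `n`-series on the right converges absolutely. The harmonic average is a finite sum over
`newforms0 N 2` (`finite_newforms0_holds`), exchanged with the absolutely convergent `n`-sum.
[cite: Bettin2017, §2 (2.3)] -/
theorem harmonicSum_heckeLambda_mul_dampedTwist [NeZero N] (m : ℕ) {y : ℝ} (hy : 0 < y) :
    Summable (fun n : ℕ ↦
      ‖(((n : ℝ) ^ (-(1 / 2 : ℝ)) * Real.exp (-(2 * Real.pi * n) * y) : ℝ) : ℂ) *
        KowalskiMichel2000.pet N m n‖) ∧
    GL2Family.harmonicSum N 2
        (fun f ↦ GL2Family.heckeLambda f m * dampedTwist f (fun _ ↦ 1) y) =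
      ∑' n : ℕ, (((n : ℝ) ^ (-(1 / 2 : ℝ)) * Real.exp (-(2 * Real.pi * n) * y) : ℝ) : ℂ) *
        KowalskiMichel2000.pet N m n := by
  have hfin := finite_newforms0_holds N 2
  -- name the weight `w n = n^{-1/2} e^{-2πny}` (an opaque local function keeps the terms small)
  obtain ⟨w, hw⟩ : ∃ w : ℕ → ℂ, ∀ n : ℕ,
      (((n : ℝ) ^ (-(1 / 2 : ℝ)) * Real.exp (-(2 * Real.pi * n) * y) : ℝ) : ℂ) = w n :=
    ⟨_, fun _ ↦ rfl⟩
  -- termwise: `a_f(n) e^{-2πny}/n = w(n) λ_f(n)`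
  have hterm : ∀ (f : CuspForm (Gamma0 N) 2) (n : ℕ),
      (1 : ℂ) * cuspCoeff f n * (Real.exp (-(2 * Real.pi * n) * y) / n : ℝ) =
        w n * GL2Family.heckeLambda f n := by
    intro f n
    rw [cuspCoeff_mul_exp_div_eq, hw]
  -- the summands `ω_f λ_f(m) · w(n) λ_f(n)` are summable in `n` for each `f`
  have hg_sum : ∀ f ∈ hfin.toFinset, Summable fun n : ℕ ↦ (GL2Family.harmonicWeight f : ℂ) *
      (GL2Family.heckeLambda f m * (w n * GL2Family.heckeLambda f n)) := by
    intro f _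
    have hs := summable_harmonicWeight_mul_heckeLambda_mul f m hy
    simp_rw [hw] at hs
    exact hs
  -- `w(n) · pet N m n = Σ_{f} ω_f λ_f(m) · w(n) λ_f(n)` (a finite sum)
  have hpet : ∀ n : ℕ, w n * KowalskiMichel2000.pet N m n = ∑ f ∈ hfin.toFinset,
      (GL2Family.harmonicWeight f : ℂ) *
        (GL2Family.heckeLambda f m * (w n * GL2Family.heckeLambda f n)) := by
    intro n
    unfold KowalskiMichel2000.pet GL2Family.harmonicSum
    rw [finsum_mem_eq_finite_toFinset_sum _ hfin, Finset.mul_sum]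
    refine Finset.sum_congr rfl fun f _ ↦ ?_
    ring
  simp_rw [hw]
  refine ⟨?_, ?_⟩
  · -- absolute convergence: a finite sum of summable series, in the finite-dimensional space `ℂ`
    have h : Summable fun n : ℕ ↦ w n * KowalskiMichel2000.pet N m n := by
      simp_rw [hpet]
      exact summable_sum hg_sum
    exact h.norm
  · -- the identity: open `Σ^h`, push `ω_f λ_f(m)` inside each `D_f`, exchange the two sums
    unfold GL2Family.harmonicSum
    rw [finsum_mem_eq_finite_toFinset_sum _ hfin]
    have hf_each : ∀ f ∈ hfin.toFinset, (GL2Family.harmonicWeight f : ℂ) *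
        (GL2Family.heckeLambda f m * dampedTwist f (fun _ ↦ 1) y) =
          ∑' n : ℕ, (GL2Family.harmonicWeight f : ℂ) *
            (GL2Family.heckeLambda f m * (w n * GL2Family.heckeLambda f n)) := by
      intro f _
      unfold dampedTwist
      simp_rw [hterm]
      rw [tsum_mul_left, tsum_mul_left]
    rw [Finset.sum_congr rfl hf_each, ← Summable.tsum_finsetSum hg_sum]
    exact tsum_congr fun n ↦ (hpet n).symm

/-- The registered stub S2 of the I2 skeleton `hecke_afe_petersson`, in its registered quantifier
shape. [cite: Bettin2017, §2 (2.3)] -/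
theorem harmonicSum_heckeLambda_mul_dampedTwist_all :
    ∀ (N : ℕ) [NeZero N] (m : ℕ) (y : ℝ), 0 < y →
      Summable (fun n : ℕ ↦
        ‖(((n : ℝ) ^ (-(1 / 2 : ℝ)) * Real.exp (-(2 * Real.pi * n) * y) : ℝ) : ℂ) *
          KowalskiMichel2000.pet N m n‖) ∧
      GL2Family.harmonicSum N 2
          (fun f ↦ GL2Family.heckeLambda f m * dampedTwist f (fun _ ↦ 1) y) =
        ∑' n : ℕ, (((n : ℝ) ^ (-(1 / 2 : ℝ)) * Real.exp (-(2 * Real.pi * n) * y) : ℝ) : ℂ) *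
          KowalskiMichel2000.pet N m n :=
  fun _ _ m _ hy ↦ harmonicSum_heckeLambda_mul_dampedTwist m hy

end Literature.NumberTheory.LFunctions.Bettin2017

end
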